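import Summits.QuantumFields.YangMills.Theorems.UnitScaleTiltProp7CombFrameLinearResponseOfRegPrT3
import Summits.QuantumFields.YangMills.Theorems.UnitScaleTiltProp7QSymFlat
import Summits.QuantumFields.YangMills.Theorems.UnitScaleTiltProp7CombTildLinearResponse
import HarnessLib

/-!
# Route `UnitScaleTilt`, crux K1 «MinimiserStabilityRegPr» (stmt-QuantumFields-19200), route-R E′ (A′)-on-Σ, P-A2 (β), row `hMcomb₂` ⟸ H2-1 — H-3 LETTERS
# «THE MEMBER's TWO INPUTS OF H-1 AT A PRINTED-REGULAR BACKGROUND»: (h0) the level-0 comb family `A′ ↦ (e^{A′})♯` is bondwise differentiable at `0` with velocity `A♯`;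
# (hW) every block loop of every level `k ≤ K − n` of print's background tower `Ū₀♯ᵏ` is within `1∕64` of `1`; hence (hcomb) **`D[A′ ↦ Ũˡ[(e^{A′})♯](z, κ)](0) A = Q l (A♯) z κ`**
# for every `l ≤ K − n` and EVERY linearised-tower family `Q` of ★routeR-w1's ✓`Prop7CornerCombStructure` (texts VERBATIM).

Cell `ym3-torus` (HUMAN RULING D-0037: YM₃ on the torus is ladder rung R3 — not d = 4, not a mass gap, not Clay), twin-width seat `ym-routeR-w2` (gen 10), on ★px17 g4's word
07:57:31Z «routeR-w2: H-3 letters GO» (SPEC there); ★★OWNER RULINGS №20 (1) (`hMcomb₂`), №22 (c).  `--supports stmt-QuantumFields-19200 --as helper`; THEOREMS ONLY (0 `def`, 0 `sorry`);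
count-neutral.  «route-internal row (n3)-comb₂ — NOT N06, NOT a print row; OPEN».  Nothing of `hMcomb`, `hMcomb₂`, H2-1, (β), `hPA2`, `hcoS`, E′, EX, the crux, d = 4 or the gap is claimed.

THE POINT.  ★px17 g4's H-1 ✓`Prop7CombTildLinearResponse.fderiv_coe_tildIter_eq_linTower` identifies, for ANY units family `U₁` through `1` and ANY background `U₀`, the bondwise Fréchet
derivative of print's single-bar comb tower `t ↦ Ũˡ[U₁ t]` ([Balaban1985Averaging] (65)∕(68)∕(69)) with ★routeR-w1 g9's linearised cornered tower `Q l` applied to the velocity of `U₁`,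
under two inputs: (h0) bondwise differentiability of `U₁` at the base parameter, (hW) the block loops `Ū₀ᵏ(Γ_{c,x})Ū₀ᵏ(c)⁻¹` of the background tower in the unit window of the series
logarithm (42).  At the MEMBER of px13 g6's SIGNATURE-0′ `hMcomb₂` — `U₀♯ := pull (bgUnits F K W) (basePt F n K)`, `U₁ A′ := pull (fun b ↦ expUnit (A′ b)) (basePt F n K)`, base `A′ = 0`
(✓`Prop7CombFrameLinearResponseStep.comb_family_zero`) — both inputs are kinematics of the tree: (h0) is Mathlib's `hasFDerivAt_exp_zero` through the bond projection
(✓`Prop7QSymFlat.hasFDerivAt_coe_expUnit_zero`, lit ✓`pull_apply`), with velocity `A♯ := fun x μ ↦ A ⟨transl x₀ x, μ⟩` (`= pull A x₀` by `rfl`); (hW) is lit ✓`B7Eq123General.level_data`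
((52)–(54): the averaged backgrounds `Ū₀♯ᵏ`, `k ≤ K − n`, stay in `U1` with plaquettes `< 2α₀(Lᵏ∕L^{K−n})² ≤ 1∕(1024(d+1)(d+4)L²)`, `α₀ = 2ε₀`) ∘ lit ✓`B7Prop2Explicit.norm_Wcx_sub_one_le`
((44)∕(47): a block loop of side `L` over plaquettes `≤ α` is within `16(d+1)(d+4)L²α` of `1`), on this lineage's ✓`Prop7CombFrameLinearResponseOfRegPr.tower_data_of_regPr` (the pulled-back
background of `W ∈ RegPr` is `SU(2)`-valued with (52) at `α₀ = 2ε₀`) and ✓`Prop7FrameResponseCombSU2.windows_of_ten7` (`C₀(3)·2ε₀ ≤ ⅓`, `8ε₀ ≤ c₂′(3, L)` from `10⁷L³ε₀ ≤ 1`) — the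
6-line `hbg` block of ★px17 ✓`Prop7CombTowerLevelUnitarity.Wcx_window_of_mem` as a named theorem, at EVERY base point `q` (not only corners).  `1∕64` serves H-1's `< 1` and F-2b's
`α ≤ 1∕24` at once.

WHAT IS PROVED (ns `…Theorems.Prop7CombTildLinearResponseOfRegPr`; member `(F, n, K)`, `M₂(ℂ)`).
* §1 (h0): `hasFDerivAt_coe_pull_expUnit_zero`, `differentiableAt_coe_pull_expUnit_zero`, ★ `fderiv_coe_pull_expUnit_zero_apply` (`= A ⟨transl x₀ x, μ⟩`), `velocity_eq` (the velocity
  field IS `A♯`, as functions), `velocity_eq_pull` (`A♯ = pull A x₀`).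
* §2 (hW): ★★ `norm_Wcx_avgIter_sub_one_le_of_regPr` (`≤ 1∕64`, every `k ≤ K − n`, every base point), `norm_Wcx_avgIter_sub_one_lt_one_of_regPr` (H-1's shape `< 1` at the corners `L•z`,
  every `k < K − n`), `avgIter_pull_mem_U1_of_regPr` (the level-`k` background is bi-contractive — F-2b's `hV₀` currency is `unitaryUnits`; `U1` recorded for the loop rows).
* §3 (hcomb): ★★★ `fderiv_coe_tildIter_eq_linTower_of_regPr` — for `RegPr F n K ε₀ W`, `10⁷L³ε₀ ≤ 1`, ANY `Q` with ✓p704390's `hQ0`∕`hQs` texts at `(L, U₀♯)`, every `A`, `l ≤ K − n`,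
  `z`, `κ`: `DifferentiableAt` AND `fderiv ℂ (A′ ↦ ↑(Ũˡ[(e^{A′})♯](z, κ))) 0 A = Q l (fun x μ ↦ A ⟨transl x₀ x, μ⟩) z κ`; `…_pull` (the same with `Q l (pull A x₀)`).
HONEST SCOPE.  Kinematics∕windows over landed rows; no estimate of H2-1; `hMcomb₂` untouched.  Rung R3, not Clay; YM gap NOT proved.

References: T. Bałaban, CMP **98** (1985) 17–51 [Balaban1985Averaging] ((8)–(9) pp.18–19, (42)–(44) pp.23–24, (47) p.25, (52)–(54) p.26, (65)∕(68)∕(69) p.29, (119) p.35);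
CMP **99** (1985) 75–102 [Balaban1985RegularSpaces] ((1.139)–(1.140) p.100); CMP **109** (1987) 249–301 [Balaban1987RG1] ((0.4) p.253).
-/

set_option autoImplicit false

noncomputable section

open scoped Matrix.Norms.L2Operator BigOperators Topology

namespace Summit.QuantumFields.YangMills.Theorems.Prop7CombTildLinearResponseOfRegPr

open NormedSpace
open Literature.MathematicalPhysics.QuantumFieldTheory.Balaban1983to89
open Literature.MathematicalPhysics.QuantumFieldTheory.Balaban1983to89.T3ContinuumYM3Torus
open T3PrintedRegularMinimiser (RegPr)
open T3SectALandauChart (bgUnits)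
open B7Prop1Explicit renaming Site → LSite
open B7Prop1Explicit (expUnit val_expUnit hol boxVec Wcx Xavg gammaWord seg plaqWord U1)
open B7Prop2Explicit (avgIter pdev le_pdev norm_Wcx_sub_one_le unitaryUnits unitaryUnits_le_U1)
open B7Prop2SpecialUnitary (specialUnitaryUnits specialUnitaryUnits_le_unitaryUnits)
open B7Eq92Concrete (tildIter)
open B7Prop3GeneralRotated (tsum)
open B7Eq123General (level_data)
open B7AvgClosedSpecialUnitarySharp (avgClosed_specialUnitary_of_le_twentyone)
open B8Prop7AdmittedFamily (avgIter_mem_unitaryUnits)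
open ExpMeanLog (eml)
open B10Eq27TorusAxialLog (pull pull_apply transl)
open Summit.QuantumFields.YangMills.Theorems.Prop7SPrint (basePt)
open Summit.QuantumFields.YangMills.Theorems.Prop7FrameResponseCombSU2 (windows_of_ten7)
open Summit.QuantumFields.YangMills.Theorems.Prop7CombFrameLinearResponseStep (comb_family_zero)
open Summit.QuantumFields.YangMills.Theorems.Prop7CombFrameLinearResponseOfRegPr (tower_data_of_regPr)
open Summit.QuantumFields.YangMills.Theorems.Prop7QSymFlat (hasFDerivAt_coe_expUnit_zero)
open Summit.QuantumFields.YangMills.Theorems.Prop7CombTildLinearResponse (fderiv_coe_tildIter_eq_linTower)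

variable (F : T3Family) {n K : ℕ}

/-! ## §1 (h0) The level-0 comb family `A′ ↦ (e^{A′})♯` at `A′ = 0`: bondwise derivative `= A♯` -/

/-- **(h0), `HasFDerivAt` FORM**: the bond variable `A′ ↦ (e^{A′})♯(x, μ) = exp (A′⟨x₀ + x, μ⟩)` of the pulled-back comb family has derivative `A ↦ A ⟨x₀ + x, μ⟩` at `A′ = 0` (the bond
projection; Mathlib `hasFDerivAt_exp_zero` via ✓`Prop7QSymFlat.hasFDerivAt_coe_expUnit_zero`, lit ✓`pull_apply`). [cite: Balaban1985Averaging, (8)-(9) pp.18-19; Balaban1985RegularSpaces, (1.140) p.100] -/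
theorem hasFDerivAt_coe_pull_expUnit_zero (x : LSite (F.P K).d) (μ : Fin (F.P K).d) :
    HasFDerivAt (fun A' : PBond (F.P K) 0 → Matrix (Fin 2) (Fin 2) ℂ =>
        ((pull (fun b => expUnit (A' b)) (basePt F n K) x μ : (Matrix (Fin 2) (Fin 2) ℂ)ˣ) : Matrix (Fin 2) (Fin 2) ℂ))
      (ContinuousLinearMap.proj (R := ℂ) (φ := fun _ : PBond (F.P K) 0 => Matrix (Fin 2) (Fin 2) ℂ) (⟨transl (basePt F n K) x, μ⟩ : PBond (F.P K) 0)) 0 := by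
  simp only [pull_apply]
  exact hasFDerivAt_coe_expUnit_zero (P := F.P K) (m := Fin 2) ⟨transl (basePt F n K) x, μ⟩

/-- **(h0), `DifferentiableAt` FORM** (H-1 §3's hypothesis `h0` at the member). [cite: Balaban1985Averaging, (8)-(9) pp.18-19] -/
theorem differentiableAt_coe_pull_expUnit_zero (x : LSite (F.P K).d) (μ : Fin (F.P K).d) :
    DifferentiableAt ℂ (fun A' : PBond (F.P K) 0 → Matrix (Fin 2) (Fin 2) ℂ =>
        ((pull (fun b => expUnit (A' b)) (basePt F n K) x μ : (Matrix (Fin 2) (Fin 2) ℂ)ˣ) : Matrix (Fin 2) (Fin 2) ℂ)) 0 :=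
  (hasFDerivAt_coe_pull_expUnit_zero F x μ).differentiableAt

/-- ★ **(h0), THE VALUE**: `fderiv ℂ (A′ ↦ ↑((e^{A′})♯(x, μ))) 0 A = A ⟨x₀ + x, μ⟩`. [cite: Balaban1985Averaging, (8)-(9) pp.18-19; Balaban1985RegularSpaces, (1.140) p.100] -/
theorem fderiv_coe_pull_expUnit_zero_apply (x : LSite (F.P K).d) (μ : Fin (F.P K).d) (A : PBond (F.P K) 0 → Matrix (Fin 2) (Fin 2) ℂ) :
    fderiv ℂ (fun A' : PBond (F.P K) 0 → Matrix (Fin 2) (Fin 2) ℂ =>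
        ((pull (fun b => expUnit (A' b)) (basePt F n K) x μ : (Matrix (Fin 2) (Fin 2) ℂ)ˣ) : Matrix (Fin 2) (Fin 2) ℂ)) 0 A
      = A ⟨transl (basePt F n K) x, μ⟩ := by
  rw [(hasFDerivAt_coe_pull_expUnit_zero F x μ).fderiv]
  rfl

/-- **THE VELOCITY FIELD IS `A♯`** (as functions of the bond): `(x, μ) ↦ fderiv ℂ (A′ ↦ ↑((e^{A′})♯(x, μ))) 0 A` `=` `(x, μ) ↦ A ⟨x₀ + x, μ⟩`. [cite: Balaban1985Averaging, (8)-(9) pp.18-19] -/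
theorem velocity_eq (A : PBond (F.P K) 0 → Matrix (Fin 2) (Fin 2) ℂ) :
    (fun (x : LSite (F.P K).d) (μ : Fin (F.P K).d) => fderiv ℂ (fun A' : PBond (F.P K) 0 → Matrix (Fin 2) (Fin 2) ℂ =>
        ((pull (fun b => expUnit (A' b)) (basePt F n K) x μ : (Matrix (Fin 2) (Fin 2) ℂ)ˣ) : Matrix (Fin 2) (Fin 2) ℂ)) 0 A)
      = fun x μ => A ⟨transl (basePt F n K) x, μ⟩ := by
  funext x μ
  exact fderiv_coe_pull_expUnit_zero_apply F x μ A

/-- `A♯` IS the pull-back of `A` (lit `pull`, by `rfl`). [cite: Balaban1985Averaging, (9) p.18] -/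
theorem velocity_eq_pull (A : PBond (F.P K) 0 → Matrix (Fin 2) (Fin 2) ℂ) :
    (fun (x : LSite (F.P K).d) (μ : Fin (F.P K).d) => A ⟨transl (basePt F n K) x, μ⟩) = pull (G := Matrix (Fin 2) (Fin 2) ℂ) A (basePt F n K) := rfl

/-! ## §2 (hW) The block loops of every level of the background tower are within `1∕64` of `1` at `RegPr` -/

/-- The level-`k` averaged background `Ū₀♯ᵏ` of a printed-regular `W` is bi-contractive (`U1`), every `k ≤ K − n` (lit ✓`level_data` on ✓`tower_data_of_regPr`'s (52); `10⁷L³ε₀ ≤ 1` feeds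
✓`windows_of_ten7`). [cite: Balaban1985Averaging, (52)-(54) p.26; Balaban1985RegularSpaces, (1.139) p.100] -/
theorem avgIter_pull_mem_U1_of_regPr {ε₀ : ℝ} (hε₀ : 0 < ε₀) (hε : 10 ^ 7 * (F.L : ℝ) ^ 3 * ε₀ ≤ 1)
    (W : GaugeField (F.P K) 0 (Matrix.specialUnitaryGroup (Fin 2) ℂ)) (hreg : RegPr F n K ε₀ W) {k : ℕ} (hk : k ≤ K - n)
    (x : LSite (F.P K).d) (κ : Fin (F.P K).d) :
    avgIter (F.P K).L (pull (bgUnits F K W) (basePt F n K)) k x κ ∈ U1 (Matrix (Fin 2) (Fin 2) ℂ) := by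
  obtain ⟨hα3, hα4, -, -, -⟩ := windows_of_ten7 F (K := K) hε₀.le hε
  have hL2 : 2 ≤ (F.P K).L := (F.P K).hL.2
  obtain ⟨hU₀, h52⟩ := tower_data_of_regPr hε₀ W hreg (le_refl (K - n))
  have hG := avgClosed_specialUnitary_of_le_twentyone (N := 2) (by norm_num) (F.P K).d (F.P K).L
  have hα : 0 < 2 * ε₀ := by positivity
  exact (level_data (F.P K).L hL2 hG (K - n) (pull (bgUnits F K W) (basePt F n K)) hU₀ hα hα3 hα4 h52 k hk).1 x κ

/-- ★★ **(hW) — THE BLOCK LOOPS OF EVERY LEVEL OF PRINT's BACKGROUND TOWER ARE WITHIN `1∕64` OF `1`**: for `RegPr F n K ε₀ W` with `10⁷L³ε₀ ≤ 1`, every `k ≤ K − n`, EVERY base point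
`q ∈ ℤ³`, direction `κ` and box point `r`: `‖Ū₀♯ᵏ(Γ_{c,x_r})·Ū₀♯ᵏ(c)⁻¹ − 1‖ ≤ 1∕64` (`c = (q, κ)`).  Lit ✓`level_data` (plaquettes of `Ū₀♯ᵏ` `< 2α₀(Lᵏ∕L^{K−n})² ≤ 1∕(1024(d+1)(d+4)L²)`,
`α₀ = 2ε₀`) ∘ lit ✓`norm_Wcx_sub_one_le` (`≤ 16(d+1)(d+4)L²·α`) — ★px17 ✓`Wcx_window_of_mem`'s `hbg` block, every level, every base point. [cite: Balaban1985Averaging, (42)-(44) pp.23-24, (47) p.25, (52)-(54) p.26] -/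
theorem norm_Wcx_avgIter_sub_one_le_of_regPr {ε₀ : ℝ} (hε₀ : 0 < ε₀) (hε : 10 ^ 7 * (F.L : ℝ) ^ 3 * ε₀ ≤ 1)
    (W : GaugeField (F.P K) 0 (Matrix.specialUnitaryGroup (Fin 2) ℂ)) (hreg : RegPr F n K ε₀ W) {k : ℕ} (hk : k ≤ K - n)
    (q : LSite (F.P K).d) (κ : Fin (F.P K).d) (r : Fin (F.P K).d → Fin (F.P K).L) :
    ‖((Wcx (F.P K).L (avgIter (F.P K).L (pull (bgUnits F K W) (basePt F n K)) k) q κ (boxVec (F.P K).L r) : (Matrix (Fin 2) (Fin 2) ℂ)ˣ) : Matrix (Fin 2) (Fin 2) ℂ) - 1‖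
      ≤ 1 / 64 := by
  obtain ⟨hα3, hα4, -, -, -⟩ := windows_of_ten7 F (K := K) hε₀.le hε
  have hL2 : 2 ≤ (F.P K).L := (F.P K).hL.2
  have hL1 : 1 ≤ (F.P K).L := le_trans (by norm_num) hL2
  obtain ⟨hU₀, h52⟩ := tower_data_of_regPr hε₀ W hreg (le_refl (K - n))
  have hG := avgClosed_specialUnitary_of_le_twentyone (N := 2) (by norm_num) (F.P K).d (F.P K).L
  have hα : 0 < 2 * ε₀ := by positivity
  obtain ⟨hV, hαj0, hpdev, hαjle⟩ := level_data (F.P K).L hL2 hG (K - n) (pull (bgUnits F K W) (basePt F n K)) hU₀ hα hα3 hα4 h52 k hk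
  set αj : ℝ := 2 * (2 * ε₀ * ((((F.P K).L : ℝ)) ^ k * ((((F.P K).L : ℝ)) ^ (K - n))⁻¹) ^ 2) with hαj
  have hd0 : (0 : ℝ) ≤ (F.P K).d := Nat.cast_nonneg _
  have hDpos : 0 < 1024 * (((F.P K).d : ℝ) + 1) * (((F.P K).d : ℝ) + 4) * ((F.P K).L : ℝ) ^ 2 := by positivity
  have hsmallj : 512 * ((F.P K).d + 1) * ((F.P K).d + 4) * ((F.P K).L : ℝ) ^ 2 * αj ≤ 1 := by
    have h1 : 512 * (((F.P K).d : ℝ) + 1) * (((F.P K).d : ℝ) + 4) * ((F.P K).L : ℝ) ^ 2 * αj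
        ≤ 512 * (((F.P K).d : ℝ) + 1) * (((F.P K).d : ℝ) + 4) * ((F.P K).L : ℝ) ^ 2 * (1 / (1024 * (((F.P K).d : ℝ) + 1) * (((F.P K).d : ℝ) + 4) * ((F.P K).L : ℝ) ^ 2)) :=
      mul_le_mul_of_nonneg_left hαjle (by positivity)
    have h2 : 512 * (((F.P K).d : ℝ) + 1) * (((F.P K).d : ℝ) + 4) * ((F.P K).L : ℝ) ^ 2 * (1 / (1024 * (((F.P K).d : ℝ) + 1) * (((F.P K).d : ℝ) + 4) * ((F.P K).L : ℝ) ^ 2))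
        = 1 / 2 := by
      field_simp; ring
    linarith
  have h44 : ∀ (x : LSite (F.P K).d) (κ κ' : Fin (F.P K).d), κ ≠ κ' →
      ‖((hol (avgIter (F.P K).L (pull (bgUnits F K W) (basePt F n K)) k) x (plaqWord κ κ') : (Matrix (Fin 2) (Fin 2) ℂ)ˣ) : Matrix (Fin 2) (Fin 2) ℂ) - 1‖ ≤ αj :=
    fun x κ κ' _ => (le_pdev hV x κ κ').trans hpdev.le
  refine (norm_Wcx_sub_one_le (F.P K).L hL1 (avgIter (F.P K).L (pull (bgUnits F K W) (basePt F n K)) k) hV hαj0 hsmallj h44 q κ r).trans ?_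
  have h1 : 2 * (8 * ((F.P K).d + 1) * ((F.P K).d + 4) * ((F.P K).L : ℝ) ^ 2 * αj)
      ≤ 2 * (8 * (((F.P K).d : ℝ) + 1) * (((F.P K).d : ℝ) + 4) * ((F.P K).L : ℝ) ^ 2 * (1 / (1024 * (((F.P K).d : ℝ) + 1) * (((F.P K).d : ℝ) + 4) * ((F.P K).L : ℝ) ^ 2))) := by
    exact mul_le_mul_of_nonneg_left (mul_le_mul_of_nonneg_left hαjle (by positivity)) (by norm_num)
  have h2 : 2 * (8 * (((F.P K).d : ℝ) + 1) * (((F.P K).d : ℝ) + 4) * ((F.P K).L : ℝ) ^ 2 * (1 / (1024 * (((F.P K).d : ℝ) + 1) * (((F.P K).d : ℝ) + 4) * ((F.P K).L : ℝ) ^ 2)))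
      = 1 / 64 := by
    field_simp; ring
  linarith

/-- **(hW) IN H-1's SHAPE**: at the corners `L•z`, every `k < K − n`, strict unit window (`1∕64 < 1`). [cite: Balaban1985Averaging, (42)-(44) pp.23-24, (52)-(54) p.26] -/
theorem norm_Wcx_avgIter_sub_one_lt_one_of_regPr {ε₀ : ℝ} (hε₀ : 0 < ε₀) (hε : 10 ^ 7 * (F.L : ℝ) ^ 3 * ε₀ ≤ 1)
    (W : GaugeField (F.P K) 0 (Matrix.specialUnitaryGroup (Fin 2) ℂ)) (hreg : RegPr F n K ε₀ W) :
    ∀ k : ℕ, k < K - n → ∀ (z : LSite (F.P K).d) (κ : Fin (F.P K).d) (r : Fin (F.P K).d → Fin (F.P K).L),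
      ‖((Wcx (F.P K).L (avgIter (F.P K).L (pull (bgUnits F K W) (basePt F n K)) k) ((((F.P K).L : ℕ) : ℤ) • z) κ (boxVec (F.P K).L r) :
          (Matrix (Fin 2) (Fin 2) ℂ)ˣ) : Matrix (Fin 2) (Fin 2) ℂ) - 1‖ < 1 :=
  fun k hk z κ r => (norm_Wcx_avgIter_sub_one_le_of_regPr F hε₀ hε W hreg hk.le _ κ r).trans_lt (by norm_num)

/-! ## §3 (hcomb) ★★★ The member's single-bar linear response IS the linearised cornered tower -/

/-- ★★★ **(hcomb) — AT A PRINTED-REGULAR BACKGROUND, `D[A′ ↦ Ũˡ[(e^{A′})♯](z, κ)](0) A = Q l (A♯) z κ` FOR EVERY LINEARISED-TOWER FAMILY `Q`.**  For `RegPr F n K ε₀ W` with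
`10⁷L³ε₀ ≤ 1`, ANY `Q` carrying the recursion texts `hQ0`∕`hQs` of ★routeR-w1 ✓`Prop7CornerCombStructure.exists_linTower_family` at `(L, U₀♯)` VERBATIM, every direction `A`, every
`l ≤ K − n` and bond `(z, κ)`: `A′ ↦ ↑(Ũˡ[(e^{A′})♯](z, κ))` is differentiable at `0` AND its derivative at `A` is `Q l (fun x μ ↦ A ⟨x₀ + x, μ⟩) z κ` — ★px17 H-1
✓`fderiv_coe_tildIter_eq_linTower` ∘ §1 (h0) ∘ §2 (hW) ∘ ✓`comb_family_zero`.  So px13's SIGNATURE-0′ linear part is `Q l (A♯)` by name.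
[cite: Balaban1985Averaging, (65) p.29, (68)-(69) p.29, (119) p.35; Balaban1987RG1, (0.4) p.253] -/
theorem fderiv_coe_tildIter_eq_linTower_of_regPr {ε₀ : ℝ} (hε₀ : 0 < ε₀) (hε : 10 ^ 7 * (F.L : ℝ) ^ 3 * ε₀ ≤ 1)
    (W : GaugeField (F.P K) 0 (Matrix.specialUnitaryGroup (Fin 2) ℂ)) (hreg : RegPr F n K ε₀ W)
    (Q : ℕ → (LSite (F.P K).d → Fin (F.P K).d → Matrix (Fin 2) (Fin 2) ℂ) → LSite (F.P K).d → Fin (F.P K).d → Matrix (Fin 2) (Fin 2) ℂ) (hQ0 : ∀ Y, Q 0 Y = Y)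
    (hQs : ∀ (k : ℕ) (Y : LSite (F.P K).d → Fin (F.P K).d → Matrix (Fin 2) (Fin 2) ℂ) (z : LSite (F.P K).d) (κ : Fin (F.P K).d), Q (k + 1) Y z κ
        = fderiv ℂ (eml : ((Fin (F.P K).d → Fin (F.P K).L) → Matrix (Fin 2) (Fin 2) ℂ) → Matrix (Fin 2) (Fin 2) ℂ)
              (fun r => ((Wcx (F.P K).L (avgIter (F.P K).L (pull (bgUnits F K W) (basePt F n K)) k) ((((F.P K).L : ℕ) : ℤ) • z) κ (boxVec (F.P K).L r) :
                (Matrix (Fin 2) (Fin 2) ℂ)ˣ) : Matrix (Fin 2) (Fin 2) ℂ))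
              (fun r => tsum (avgIter (F.P K).L (pull (bgUnits F K W) (basePt F n K)) k) (Q k Y) ((((F.P K).L : ℕ) : ℤ) • z)
                  (gammaWord (F.P K).L κ (boxVec (F.P K).L r) ++ seg κ (-(((F.P K).L : ℕ) : ℤ)))
                * ((Wcx (F.P K).L (avgIter (F.P K).L (pull (bgUnits F K W) (basePt F n K)) k) ((((F.P K).L : ℕ) : ℤ) • z) κ (boxVec (F.P K).L r) :
                  (Matrix (Fin 2) (Fin 2) ℂ)ˣ) : Matrix (Fin 2) (Fin 2) ℂ))
              * (((expUnit (Xavg (F.P K).L (avgIter (F.P K).L (pull (bgUnits F K W) (basePt F n K)) k) ((((F.P K).L : ℕ) : ℤ) • z) κ))⁻¹ :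
                (Matrix (Fin 2) (Fin 2) ℂ)ˣ) : Matrix (Fin 2) (Fin 2) ℂ)
            + ((expUnit (Xavg (F.P K).L (avgIter (F.P K).L (pull (bgUnits F K W) (basePt F n K)) k) ((((F.P K).L : ℕ) : ℤ) • z) κ) :
                (Matrix (Fin 2) (Fin 2) ℂ)ˣ) : Matrix (Fin 2) (Fin 2) ℂ)
              * tsum (avgIter (F.P K).L (pull (bgUnits F K W) (basePt F n K)) k) (Q k Y) ((((F.P K).L : ℕ) : ℤ) • z) (seg κ (((F.P K).L : ℕ) : ℤ))
              * (((expUnit (Xavg (F.P K).L (avgIter (F.P K).L (pull (bgUnits F K W) (basePt F n K)) k) ((((F.P K).L : ℕ) : ℤ) • z) κ))⁻¹ :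
                (Matrix (Fin 2) (Fin 2) ℂ)ˣ) : Matrix (Fin 2) (Fin 2) ℂ))
    (A : PBond (F.P K) 0 → Matrix (Fin 2) (Fin 2) ℂ) {l : ℕ} (hl : l ≤ K - n) (z : LSite (F.P K).d) (κ : Fin (F.P K).d) :
    DifferentiableAt ℂ (fun A' : PBond (F.P K) 0 → Matrix (Fin 2) (Fin 2) ℂ =>
        ((tildIter (F.P K).L (pull (bgUnits F K W) (basePt F n K)) (pull (fun b => expUnit (A' b)) (basePt F n K)) l z κ : (Matrix (Fin 2) (Fin 2) ℂ)ˣ) :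
          Matrix (Fin 2) (Fin 2) ℂ)) 0 ∧
      fderiv ℂ (fun A' : PBond (F.P K) 0 → Matrix (Fin 2) (Fin 2) ℂ =>
          ((tildIter (F.P K).L (pull (bgUnits F K W) (basePt F n K)) (pull (fun b => expUnit (A' b)) (basePt F n K)) l z κ : (Matrix (Fin 2) (Fin 2) ℂ)ˣ) :
            Matrix (Fin 2) (Fin 2) ℂ)) 0 A
        = Q l (fun x μ => A ⟨transl (basePt F n K) x, μ⟩) z κ := by
  letI : CStarAlgebra (Matrix (Fin 2) (Fin 2) ℂ) := B10Eq29TubeLine.cstarAlgebraMatrix 2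
  have h := fderiv_coe_tildIter_eq_linTower (E := PBond (F.P K) 0 → Matrix (Fin 2) (Fin 2) ℂ) (F.P K).L (pull (bgUnits F K W) (basePt F n K))
    (fun A' : PBond (F.P K) 0 → Matrix (Fin 2) (Fin 2) ℂ => pull (fun b => expUnit (A' b)) (basePt F n K)) (a := 0) (comb_family_zero F)
    (differentiableAt_coe_pull_expUnit_zero F) Q hQ0 hQs (norm_Wcx_avgIter_sub_one_lt_one_of_regPr F hε₀ hε W hreg) A l hl
  refine ⟨h.1 z κ, ?_⟩
  rw [h.2 z κ, velocity_eq]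

/-- ★★★ **(hcomb), `pull` FORM**: the same with the velocity written `pull A x₀` (`rfl`). [cite: Balaban1985Averaging, (9) p.18, (68)-(69) p.29, (119) p.35] -/
theorem fderiv_coe_tildIter_eq_linTower_pull_of_regPr {ε₀ : ℝ} (hε₀ : 0 < ε₀) (hε : 10 ^ 7 * (F.L : ℝ) ^ 3 * ε₀ ≤ 1)
    (W : GaugeField (F.P K) 0 (Matrix.specialUnitaryGroup (Fin 2) ℂ)) (hreg : RegPr F n K ε₀ W)
    (Q : ℕ → (LSite (F.P K).d → Fin (F.P K).d → Matrix (Fin 2) (Fin 2) ℂ) → LSite (F.P K).d → Fin (F.P K).d → Matrix (Fin 2) (Fin 2) ℂ) (hQ0 : ∀ Y, Q 0 Y = Y)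
    (hQs : ∀ (k : ℕ) (Y : LSite (F.P K).d → Fin (F.P K).d → Matrix (Fin 2) (Fin 2) ℂ) (z : LSite (F.P K).d) (κ : Fin (F.P K).d), Q (k + 1) Y z κ
        = fderiv ℂ (eml : ((Fin (F.P K).d → Fin (F.P K).L) → Matrix (Fin 2) (Fin 2) ℂ) → Matrix (Fin 2) (Fin 2) ℂ)
              (fun r => ((Wcx (F.P K).L (avgIter (F.P K).L (pull (bgUnits F K W) (basePt F n K)) k) ((((F.P K).L : ℕ) : ℤ) • z) κ (boxVec (F.P K).L r) :
                (Matrix (Fin 2) (Fin 2) ℂ)ˣ) : Matrix (Fin 2) (Fin 2) ℂ))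
              (fun r => tsum (avgIter (F.P K).L (pull (bgUnits F K W) (basePt F n K)) k) (Q k Y) ((((F.P K).L : ℕ) : ℤ) • z)
                  (gammaWord (F.P K).L κ (boxVec (F.P K).L r) ++ seg κ (-(((F.P K).L : ℕ) : ℤ)))
                * ((Wcx (F.P K).L (avgIter (F.P K).L (pull (bgUnits F K W) (basePt F n K)) k) ((((F.P K).L : ℕ) : ℤ) • z) κ (boxVec (F.P K).L r) :
                  (Matrix (Fin 2) (Fin 2) ℂ)ˣ) : Matrix (Fin 2) (Fin 2) ℂ))
              * (((expUnit (Xavg (F.P K).L (avgIter (F.P K).L (pull (bgUnits F K W) (basePt F n K)) k) ((((F.P K).L : ℕ) : ℤ) • z) κ))⁻¹ :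
                (Matrix (Fin 2) (Fin 2) ℂ)ˣ) : Matrix (Fin 2) (Fin 2) ℂ)
            + ((expUnit (Xavg (F.P K).L (avgIter (F.P K).L (pull (bgUnits F K W) (basePt F n K)) k) ((((F.P K).L : ℕ) : ℤ) • z) κ) :
                (Matrix (Fin 2) (Fin 2) ℂ)ˣ) : Matrix (Fin 2) (Fin 2) ℂ)
              * tsum (avgIter (F.P K).L (pull (bgUnits F K W) (basePt F n K)) k) (Q k Y) ((((F.P K).L : ℕ) : ℤ) • z) (seg κ (((F.P K).L : ℕ) : ℤ))
              * (((expUnit (Xavg (F.P K).L (avgIter (F.P K).L (pull (bgUnits F K W) (basePt F n K)) k) ((((F.P K).L : ℕ) : ℤ) • z) κ))⁻¹ :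
                (Matrix (Fin 2) (Fin 2) ℂ)ˣ) : Matrix (Fin 2) (Fin 2) ℂ))
    (A : PBond (F.P K) 0 → Matrix (Fin 2) (Fin 2) ℂ) {l : ℕ} (hl : l ≤ K - n) (z : LSite (F.P K).d) (κ : Fin (F.P K).d) :
    fderiv ℂ (fun A' : PBond (F.P K) 0 → Matrix (Fin 2) (Fin 2) ℂ =>
        ((tildIter (F.P K).L (pull (bgUnits F K W) (basePt F n K)) (pull (fun b => expUnit (A' b)) (basePt F n K)) l z κ : (Matrix (Fin 2) (Fin 2) ℂ)ˣ) :
          Matrix (Fin 2) (Fin 2) ℂ)) 0 A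
      = Q l (pull (G := Matrix (Fin 2) (Fin 2) ℂ) A (basePt F n K)) z κ :=
  (fderiv_coe_tildIter_eq_linTower_of_regPr F hε₀ hε W hreg Q hQ0 hQs A hl z κ).2

end Summit.QuantumFields.YangMills.Theorems.Prop7CombTildLinearResponseOfRegPr

end
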